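import Mathlib
import HarnessLib
import Literature.MathematicalPhysics.QuantumLattice.GaugeGroups
import Literature.LinearAlgebra.Matrix.UnitaryGroupMaximalTorus
import Literature.LinearAlgebra.Matrix.SpecialUnitaryGroupConjugacyClasses
import Summits.Ventures.LatticeQCDFlow.Exactness.KernelCouplingJacobian
import Summits.Ventures.LatticeQCDFlow.Exactness.SpectralCouplingMeasurable
import Summits.Ventures.LatticeQCDFlow.Exactness.SU2SpectralKernelBookedDensity
import Summits.Ventures.LatticeQCDFlow.Scaling.EntropyBudgetCoupling

/-!
# The `SU(2)` spectral coupling layer AS SHIPPED — kernel updates at frozen staples, box flows parametrised by the frozen context — is an exact transport of product Haar with exactly the accumulated booked density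

HONEST FRAMING: exact (Metropolis-corrected) sampling algorithms for lattice gauge theory;
figures of merit are autocorrelation/cost numbers at stated couplings and volumes; no
continuum-physics claim.

Venture `LatticeQCDFlow` (cell pub-lqcd), topic `Exactness`; FANOUT row 10 (`eng-equiv`, engine
`latflow.equiv` `spectral.SUNSpectralCoupling` with `N = 2` / `latflow.flows_jax.sun_flow`
`preset_boyda2021` `SU(2)`: active links `U`, loop `W = U S` with frozen staple `S`, `W' = h(W | context)`,
`U' = W' W† U`, booked `Σ_active [log χ'(α) + log(4 sin² a') − log(4 sin² a)]`; Boyda et al., PRD 103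
(2021) 074504 §III–IV, App. B).  NEW WORK of the cell: the layer-level twin of
`SU2SpectralKernelBookedDensity.lean`, through `KernelCouplingJacobian.hasJacobian_kernelCouplingLayer`
(file 9) and `SpectralCouplingMeasurable.measurable_spectralKernelUpdate_specialUnitaryGroup`
(file 18), with the per-link certificate `hasJacobian_spectralKernel_su2_booked`.  Nothing is cited
as a fact; no hypothesis names an unproved fact; no number; no definition.

## What is typed (`c : U(1) → SΔ(2)` the chart `z ↦ diag(z, z⁻¹)`, hypothesis `hc`)

* `measurable_bookedDensityAtLoop_su2` — the booked density read at the loop `u S(y)` is jointly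
  measurable in (link, frozen context) when `g`, `g'` are jointly measurable in (context, alcove
  coordinate);
* **`hasJacobian_spectralCouplingLayer_su2_booked`** — links `ι`, mask `p`, frozen staples
  `S a y` (continuous in the frozen links `y`), per-link eigenvalue maps `f a y` (jointly continuous
  on context × unimodular torus) given on the Weyl alcove by `g a y` (monotone, onto `[0,π]`,
  derivative `g' a y ≥ 0` within `[0,π]`; `g`, `g'` jointly measurable), kernels `h a y` following
  the spectral recipe.  Then
  `HasJacobian (⊗_ι Haar_{SU(2)}) (coupleFun p (u ↦ h a y (uS)(uS)⁻¹u)) (ofReal ∘ coupleJac p j)`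
  with the BOOKED per-link density at the loop,
  `j a y u = g'(a_W) sin²(g a_W)/sin²(a_W)`, `W = u · S a y`, `a_W = arccos(Re tr W/2)`.

NOT here: `N ≥ 3`; any number.
-/

noncomputable section

namespace Summit.Ventures.LatticeQCDFlow.Exactness

open MeasureTheory Matrix Topology Set Real
open Literature.LinearAlgebra.Matrix
open Literature.MathematicalPhysics.QuantumFieldTheory (haarProbability)
open scoped ENNReal

section SU2

variable {c : Circle → specialDiagonalTorus (Fin 2)}
  (hc : ∀ z, (((c z : specialDiagonalTorus (Fin 2)) : Matrix.specialUnitaryGroup (Fin 2) ℂ) :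
    Matrix (Fin 2) (Fin 2) ℂ) = diagonal ![(z : ℂ), ((z⁻¹ : Circle) : ℂ)])

/-- **The booked density at the loop is jointly measurable** in (link, frozen context). -/
theorem measurable_bookedDensityAtLoop_su2 {Y : Type*} [TopologicalSpace Y] [MeasurableSpace Y]
    [BorelSpace Y] {g g' : Y → ℝ → ℝ} (hgm : Measurable fun q : Y × ℝ => g q.1 q.2)
    (hg'm : Measurable fun q : Y × ℝ => g' q.1 q.2) {S : Y → Matrix.specialUnitaryGroup (Fin 2) ℂ}
    (hS : Continuous S) :
    Measurable fun q : Matrix.specialUnitaryGroup (Fin 2) ℂ × Y =>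
      g' q.2 (Real.arccos (su2a0 (q.1 * S q.2))) * Real.sin (g q.2 (Real.arccos (su2a0 (q.1 * S q.2)))) ^ 2 /
        Real.sin (Real.arccos (su2a0 (q.1 * S q.2))) ^ 2 := by
  have hα : Measurable fun q : Matrix.specialUnitaryGroup (Fin 2) ℂ × Y => Real.arccos (su2a0 (q.1 * S q.2)) :=
    (Real.continuous_arccos.comp (continuous_su2a0.comp (continuous_fst.mul (hS.comp continuous_snd)))).measurable
  have hpair : Measurable fun q : Matrix.specialUnitaryGroup (Fin 2) ℂ × Y =>
      (q.2, Real.arccos (su2a0 (q.1 * S q.2))) := measurable_snd.prodMk hα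
  exact ((hg'm.comp hpair).mul ((Real.continuous_sin.measurable.comp (hgm.comp hpair)).pow_const 2)).div
    ((Real.continuous_sin.measurable.comp hα).pow_const 2)

include hc

/-- **The `SU(2)` spectral coupling layer with the booked density is an exact transport of product
Haar — unconditionally and with every auxiliary object eliminated.**  See the module docstring for
the hypotheses; the conclusion is `HasJacobian (⊗_ι Haar_{SU(2)}) (coupleFun p ψ) (ofReal ∘ coupleJac p j)`
with `ψ a y u = h a y (u S a y) (u S a y)⁻¹ u` and the booked per-link density `j` at the loop. -/
theorem hasJacobian_spectralCouplingLayer_su2_booked {ι : Type*} [Fintype ι]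
    (p : ι → Prop) [DecidablePred p]
    (S : {i // p i} → ({i // ¬p i} → Matrix.specialUnitaryGroup (Fin 2) ℂ) → Matrix.specialUnitaryGroup (Fin 2) ℂ)
    (hS : ∀ a, Continuous (S a))
    (f : {i // p i} → ({i // ¬p i} → Matrix.specialUnitaryGroup (Fin 2) ℂ) → (Fin 2 → ℂ) → (Fin 2 → ℂ))
    (hf : ∀ a, ContinuousOn
      (fun q : ({i // ¬p i} → Matrix.specialUnitaryGroup (Fin 2) ℂ) × (Fin 2 → ℂ) => f a q.1 q.2)
      {q | ∀ i, ‖q.2 i‖ = 1})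
    (g g' : {i // p i} → ({i // ¬p i} → Matrix.specialUnitaryGroup (Fin 2) ℂ) → ℝ → ℝ)
    (hgm : ∀ a, Measurable fun q : ({i // ¬p i} → Matrix.specialUnitaryGroup (Fin 2) ℂ) × ℝ => g a q.1 q.2)
    (hg'm : ∀ a, Measurable fun q : ({i // ¬p i} → Matrix.specialUnitaryGroup (Fin 2) ℂ) × ℝ => g' a q.1 q.2)
    (hderiv : ∀ a y, ∀ x ∈ Icc 0 π, HasDerivWithinAt (g a y) (g' a y x) (Icc 0 π) x)
    (hmono : ∀ a y, MonotoneOn (g a y) (Icc 0 π)) (himage : ∀ a y, g a y '' Icc 0 π = Icc 0 π)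
    (hg'0 : ∀ a y, ∀ x ∈ Icc 0 π, 0 ≤ g' a y x)
    (hfpos : ∀ a y, ∀ x ∈ Icc 0 π, f a y ![(Circle.exp x : ℂ), (((Circle.exp x)⁻¹ : Circle) : ℂ)] =
      ![(Circle.exp (g a y x) : ℂ), (((Circle.exp (g a y x))⁻¹ : Circle) : ℂ)])
    (hfneg : ∀ a y, ∀ x ∈ Icc 0 π, f a y ![(Circle.exp (-x) : ℂ), (((Circle.exp (-x))⁻¹ : Circle) : ℂ)] =
      ![(Circle.exp (-(g a y x)) : ℂ), (((Circle.exp (-(g a y x)))⁻¹ : Circle) : ℂ)])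
    (h : {i // p i} → ({i // ¬p i} → Matrix.specialUnitaryGroup (Fin 2) ℂ) →
      Matrix.specialUnitaryGroup (Fin 2) ℂ → Matrix.specialUnitaryGroup (Fin 2) ℂ)
    (hagree : ∀ a y (P : Matrix.specialUnitaryGroup (Fin 2) ℂ) (V : Matrix (Fin 2) (Fin 2) ℂ) (d : Fin 2 → ℂ),
      V ∈ Matrix.unitaryGroup (Fin 2) ℂ → (P : Matrix (Fin 2) (Fin 2) ℂ) = V * diagonal d * star V →
        ((h a y P : Matrix.specialUnitaryGroup (Fin 2) ℂ) : Matrix (Fin 2) (Fin 2) ℂ) =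
          V * diagonal (f a y d) * star V) :
    HasJacobian (Measure.pi fun _ : ι => haarProbability (Matrix.specialUnitaryGroup (Fin 2) ℂ))
      (Theory2.coupleFun p fun a y u => h a y (u * S a y) * (u * S a y)⁻¹ * u)
      fun U => ENNReal.ofReal (Theory2.coupleJac p (fun a y u =>
        g' a y (Real.arccos (su2a0 (u * S a y))) * Real.sin (g a y (Real.arccos (su2a0 (u * S a y)))) ^ 2 /
          Real.sin (Real.arccos (su2a0 (u * S a y))) ^ 2) U) := by
  -- fibrewise data
  have hfc : ∀ a y, ContinuousOn (f a y) {d | ∀ i, ‖d i‖ = 1} := by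
    intro a y
    have hslice : Continuous fun d : Fin 2 → ℂ => ((y, d) :
        ({i // ¬p i} → Matrix.specialUnitaryGroup (Fin 2) ℂ) × (Fin 2 → ℂ)) :=
      continuous_const.prodMk continuous_id
    exact (hf a).comp hslice.continuousOn fun d hd => hd
  have hgy : ∀ a y, Measurable (g a y) := fun a y => (hgm a).comp (measurable_const.prodMk measurable_id)
  have hg'y : ∀ a y, Measurable (g' a y) := fun a y => (hg'm a).comp (measurable_const.prodMk measurable_id)
  refine hasJacobian_kernelCouplingLayer p S h
    (fun a y W => g' a y (Real.arccos (su2a0 W)) * Real.sin (g a y (Real.arccos (su2a0 W))) ^ 2 /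
      Real.sin (Real.arccos (su2a0 W)) ^ 2)
    (fun a => measurable_spectralKernelUpdate_specialUnitaryGroup (hf a) (hagree a) (hS a))
    (fun a => measurable_bookedDensityAtLoop_su2 (hgm a) (hg'm a) (hS a))
    (fun a y => hasJacobian_spectralKernel_su2_booked hc (hfc a y) (hgy a y) (hg'y a y) (hderiv a y)
      (hmono a y) (himage a y) (hg'0 a y) (hfpos a y) (hfneg a y) (hagree a y))
    fun a y W => ?_
  -- the booked density is nonnegative (`a_W ∈ [0, π]`)
  have hα : Real.arccos (su2a0 W) ∈ Icc 0 π := ⟨Real.arccos_nonneg _, Real.arccos_le_pi _⟩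
  exact div_nonneg (mul_nonneg (hg'0 a y _ hα) (sq_nonneg _)) (sq_nonneg _)

end SU2

end Summit.Ventures.LatticeQCDFlow.Exactness
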